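import Summits.AtomisticToContinuum.HydrodynamicLimit.Theorems.JParityClosureLocalSecondLawThermalHeatFluxBounds
import Literature.Analysis.FluidPDE.HardSphereTrajectoryMeasurable

/-!
# `T₃kin` is an honest Bochner integral on the regular event; the deterministic core of P3
(stmt-AtomisticToContinuum-13081, line `exact-entropy-ledger-three-passivities`; support of the stub
`stub_passivityThermal` (P3); file 2 of 3 of the thermal package, after `…ThermalHeatFluxBounds.lean`)

1. JUNK AUDIT OF `T₃ = T₃kin + T₃coll`, made formal for the kinetic half: **on the regular event both Bochner
   integrals of `T₃kin = ∫₀^τ∫ ∑ₖ ∂ₖ(φ/θ_r) q^kin_{r,k}` are honest** (`T3kin_honest_of_regular`).  For `0 < r`, `0 < c`,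
   a smooth test function and `z ∈ Regular`: at every `s ∈ [0,τ]` the space integrand is Borel (`pD` of the continuous
   `φ/θ_r` is Borel, `measurable_pD`; `q^kin_r` is Borel) and bounded (floors `ρ_r, θ_r ≥ c`, the quotient-rule-or-junk
   bound `|∂ₖ(φ/θ_r)| ≤ |∂ₖφ|/θ_r + |φ||∂ₖθ_r|/θ_r²`, the Lipschitz bound `|∂ₖθ_r| ≤ L_θ(r,c,ke)` and the cubic-moment bound
   `‖q^kin_r‖ ≤ Q(N,r,c,ke)` of file 1), hence integrable; along the good orbit — Borel in time
   (`IsHardSphereTrajectory.measurable_torus`), energy conserved (`ke_flow_eq`) — its space integral is a bounded Borel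
   function of `s` on `[0,τ]`: it agrees there with the space integral of the jointly Borel FLOORED integrand (the test
   function over the floored temperature of file 1, jointly continuous in `((s, w), y)`, so that
   `measurable_pD_uncurry` applies; Fubini measurability `StronglyMeasurable.integral_prod_right'`), hence integrable
   on `[0,τ]`.  The collisional half `T₃coll` is a `collSum`, an honest FINITE sum on a good orbit
   (`finite_collisionTimes_Ioc` of `…CollisionalWorkRegularity.lean`).  So no junk value is taken anywhere on `Regular`:
   the stub P3 has no trivial part — as registered (unconditional, all `τ`) it is the open weak cubic heat-flux closure
   plus the vanishing of the collisional heat transfer.  The `L¹` majorant `∫₀^τ∫‖q^kin_r‖` is honest too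
   (`psvT_integrableOn_norm_qkinC`).
2. THE DETERMINISTIC CORE OF P3 (`abs_T3kin_le_of_regular`): on a regular orbit with weight bounds `|φ| ≤ M`,
   `|∂ₖφ| ≤ M'` and the thermal strain bound `r|∂ₖθ_r| ≤ K` on `[0,τ] × 𝕋³`,
   `|T₃kin| ≤ 3(M'/c + MK/(rc²)) ∫₀^τ∫ ‖q^kin_r‖` — only the MAJORANT needs honest integrals
   (`norm_integral_le_of_norm_le` at both levels).  It is the lever of the conditional form
   "cubic heat-flux `L¹`-smallness at rate `r` + thermal strain tightness at rate `1/r` + collisional heat law ⇒ P3"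
   (`Theorems/JParityClosureLocalSecondLawPassivityThermalOfClosure.lean`).

References: R. J. Hardy, J. Chem. Phys. 76 (1982) 622; H. Spohn, *Large Scale Dynamics of Interacting Particles*
(1991), Part I §3 (setting).
-/

noncomputable section

namespace Summit.AtomisticToContinuum.HydrodynamicLimit.Theorems.LocalSecondLawLedger

open scoped BigOperators Topology Classical MeasureTheory ENNReal InnerProductSpace
open Filter Set MeasureTheory
open Literature.MathematicalPhysics.KineticTheory
open Literature.Analysis.FluidPDE
open Summit.AtomisticToContinuum.HydrodynamicLimit.Theorems.LocalSecondLawNegative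

variable {N : ℕ}


/-! ## (a) `T₃kin` is an honest double Bochner integral on the regular event -/

/-- Pointwise bound of the `T₃kin` integrand: with `|f x| ≤ A`, `|∂ₖf(x)| ≤ B`, `|∂ₖθ_r(x)| ≤ D` and the floor
`c ≤ θ_r(x)`, `|∑ₖ ∂ₖ(f/θ_r)(x) q^kin_{r,k}(x)| ≤ 3(B/c + AD/c²)‖q^kin_r(x)‖` (quotient rule or junk, termwise). -/
theorem psvT_abs_T₃kin_integrand_le {r c : ℝ} (hc : 0 < c) {w : Phase N} {x : T3}
    (hθ : c ≤ thetaC r w x) (hθc : Continuous fun y => thetaC r w y) {f : T3 → ℝ}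
    (hf : ∀ k : Fin 3, DifferentiableAt ℝ (fun t : ℝ => f (x + tproj (t • EuclideanSpace.single k (1 : ℝ)))) 0)
    {A B D : ℝ} (hA : |f x| ≤ A) (hB : ∀ k, |pD k f x| ≤ B) (hD : ∀ k, |pD k (fun y => thetaC r w y) x| ≤ D) :
    |∑ k : Fin 3, pD k (fun y => f y / thetaC r w y) x * qkinC r w x k| ≤
      3 * (B / c + A * D / c ^ 2) * ‖qkinC r w x‖ := by
  have hθpos : 0 < thetaC r w x := hc.trans_le hθ
  have hA0 : 0 ≤ A := (abs_nonneg _).trans hA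
  have hB0 : 0 ≤ B := (abs_nonneg _).trans (hB 0)
  have hD0 : 0 ≤ D := (abs_nonneg _).trans (hD 0)
  have hk : ∀ k, |pD k (fun y => f y / thetaC r w y) x| ≤ B / c + A * D / c ^ 2 := by
    intro k
    refine (psvT_abs_pD_div_le (hf k) hθc hθpos).trans (add_le_add ?_ ?_)
    · exact div_le_div₀ hB0 (hB k) hc hθ
    · rw [mul_div_assoc, mul_div_assoc]
      refine mul_le_mul hA ?_ (by positivity) hA0
      exact div_le_div₀ hD0 (hD k) (by positivity) (pow_le_pow_left₀ hc.le hθ 2)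
  calc |∑ k : Fin 3, pD k (fun y => f y / thetaC r w y) x * qkinC r w x k|
      ≤ ∑ k : Fin 3, |pD k (fun y => f y / thetaC r w y) x * qkinC r w x k| := Finset.abs_sum_le_sum_abs _ _
    _ ≤ ∑ _k : Fin 3, (B / c + A * D / c ^ 2) * ‖qkinC r w x‖ := by
        refine Finset.sum_le_sum fun k _ => ?_
        rw [abs_mul]
        refine mul_le_mul (hk k) ?_ (abs_nonneg _) (by positivity)
        rw [← Real.norm_eq_abs]
        exact PiLp.norm_apply_le (qkinC r w x) k
    _ = 3 * (B / c + A * D / c ^ 2) * ‖qkinC r w x‖ := by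
        simp only [Finset.sum_const, Finset.card_univ, Fintype.card_fin, nsmul_eq_mul, Nat.cast_ofNat]
        ring

/-- The same bound on the floors `c ≤ ρ_r` (everywhere), `c ≤ θ_r(x)`, with the explicit constants `L_θ(r, c, ke)` of
`psvT_abs_pD_thetaC_le` and `Q(N, r, c, ke)` of `psvT_norm_qkinC_le`. -/
theorem psvT_abs_T₃kin_integrand_le_floor {r c : ℝ} (hr : 0 < r) (hc : 0 < c) {w : Phase N} {x : T3}
    (hρ : ∀ y, c ≤ rhoC r w y) (hθ : c ≤ thetaC r w x) {f : T3 → ℝ}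
    (hf : ∀ k : Fin 3, DifferentiableAt ℝ (fun t : ℝ => f (x + tproj (t • EuclideanSpace.single k (1 : ℝ)))) 0)
    {A B : ℝ} (hA : |f x| ≤ A) (hB : ∀ k, |pD k f x| ≤ B) :
    |∑ k : Fin 3, pD k (fun y => f y / thetaC r w y) x * qkinC r w x k| ≤
      3 * (B / c + A * (2 / 3 * (3 / (Real.pi * r ^ 4) * ke w / c + 3 / (Real.pi * r ^ 3) * ke w * (3 / (Real.pi * r ^ 4)) / c ^ 2 +
        (3 / (Real.pi * r ^ 4) * (1 / 2 + ke w) / c + 3 / (Real.pi * r ^ 3) * (1 / 2 + ke w) * (3 / (Real.pi * r ^ 4)) / c ^ 2) *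
          (3 / (Real.pi * r ^ 3) * (1 / 2 + ke w) / c))) / c ^ 2) *
      (3 / (Real.pi * r ^ 3) * (1 / 2 + ((N + 1 : ℕ) : ℝ) * ke w + 3 / (Real.pi * r ^ 3) * (1 / 2 + ke w) / c) ^ 3 / 2) := by
  have hA0 : 0 ≤ A := (abs_nonneg _).trans hA
  have hB0 : 0 ≤ B := (abs_nonneg _).trans (hB 0)
  have hke := ke_nonneg w
  refine (psvT_abs_T₃kin_integrand_le hc hθ (psvT_continuous_thetaC hc hρ) hf hA hB
    (fun k => psvT_abs_pD_thetaC_le hr hc hρ k x)).trans ?_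
  exact mul_le_mul_of_nonneg_left (psvT_norm_qkinC_le hr hc (hρ x)) (by positivity)

/-- A coordinate of `q^kin_r` is Borel in the field point. -/
theorem psvT_measurable_qkinC_apply (r : ℝ) (w : Phase N) (k : Fin 3) : Measurable fun x => qkinC r w x k := by
  have h1 := (psvT_measurable_qkinC_uncurry (N := N) r).comp (measurable_prodMk_left (x := w))
  have h2 : Continuous fun v : V3 => v k := PiLp.continuous_apply 2 (fun _ : Fin 3 => ℝ) k
  exact h2.measurable.comp h1

/-- `x ↦ ‖q^kin_r(x)‖` is Borel. -/
theorem psvT_measurable_norm_qkinC (r : ℝ) (w : Phase N) : Measurable fun x => ‖qkinC r w x‖ := by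
  have h1 := (psvT_measurable_qkinC_uncurry (N := N) r).comp (measurable_prodMk_left (x := w))
  exact h1.norm

/-- **The space integrand of `T₃kin` is Bochner integrable on the floors.**  For a configuration with `c ≤ ρ_r`,
`c ≤ θ_r` everywhere and a weight `f` continuous, line-differentiable, with `|f| ≤ A`, `|∂ₖf| ≤ B`:
`x ↦ ∑ₖ ∂ₖ(f/θ_r)(x) q^kin_{r,k}(x)` is Borel (`measurable_pD` of the continuous `f/θ_r`) and bounded, hence integrable. -/
theorem psvT_integrable_T₃kin_inner {r c : ℝ} (hr : 0 < r) (hc : 0 < c) {w : Phase N}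
    (hρ : ∀ y, c ≤ rhoC r w y) (hθ : ∀ y, c ≤ thetaC r w y) {f : T3 → ℝ} (hfc : Continuous f)
    (hf : ∀ (x : T3) (k : Fin 3), DifferentiableAt ℝ (fun t : ℝ => f (x + tproj (t • EuclideanSpace.single k (1 : ℝ)))) 0)
    {A B : ℝ} (hA : ∀ x, |f x| ≤ A) (hB : ∀ x k, |pD k f x| ≤ B) :
    Integrable (fun x => ∑ k : Fin 3, pD k (fun y => f y / thetaC r w y) x * qkinC r w x k) := by
  have hθc := psvT_continuous_thetaC (r := r) hc hρ
  have hq := fun k => psvT_measurable_qkinC_apply (N := N) r w k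
  have hdivc : Continuous fun y => f y / thetaC r w y := hfc.div hθc fun y => (hc.trans_le (hθ y)).ne'
  have hmeas : Measurable fun x => ∑ k : Fin 3, pD k (fun y => f y / thetaC r w y) x * qkinC r w x k :=
    Finset.measurable_sum _ fun k _ => (measurable_pD hdivc k).mul (hq k)
  obtain ⟨C, hC⟩ : ∃ C : ℝ, ∀ x, |∑ k : Fin 3, pD k (fun y => f y / thetaC r w y) x * qkinC r w x k| ≤ C :=
    ⟨_, fun x => psvT_abs_T₃kin_integrand_le_floor hr hc hρ (hθ x) (hf x) (hA x) (hB x)⟩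
  refine Integrable.mono' (integrable_const C) hmeas.aestronglyMeasurable (Eventually.of_forall fun x => ?_)
  rw [Real.norm_eq_abs]
  exact hC x

/-- The floored weight family `((s, w), y) ↦ φ s y / θfl_c(w, y)` is jointly continuous (`0 < c`, `φ` smooth). -/
theorem psvT_continuous_weightFl {c : ℝ} (hc : 0 < c) (r : ℝ) {φ : ℝ → T3 → ℝ}
    (hφ : Literature.Analysis.FunctionSpaces.Torus.IsSmoothSpaceTimeOn Set.univ φ) :
    Continuous fun p : (ℝ × Phase N) × T3 => φ p.1.1 p.2 /
      max (2 / 3 * (kinC r p.1.2 p.2 / max (rhoC r p.1.2 p.2) c -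
        ‖momC r p.1.2 p.2‖ ^ 2 / (2 * max (rhoC r p.1.2 p.2) c ^ 2))) c := by
  have h1p : Continuous fun p : (ℝ × Phase N) × T3 => ((p.1.1, p.2) : ℝ × T3) :=
    (continuous_fst.comp continuous_fst).prodMk continuous_snd
  have h1 := (psvT_continuous_uncurry hφ).comp h1p
  have h2p : Continuous fun p : (ℝ × Phase N) × T3 => ((p.1.2, p.2) : Phase N × T3) :=
    (continuous_snd.comp continuous_fst).prodMk continuous_snd
  have h2 := (psvT_continuous_thetaFl_uncurry (N := N) hc r).comp h2p
  exact h1.div h2 fun p => (hc.trans_le (le_max_right _ _)).ne'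

/-- `((s, w), x) ↦ ∂ₖ(φ s ·/θfl_c(w, ·))(x)` is jointly Borel (`measurable_pD_uncurry` for the continuous family). -/
theorem psvT_measurable_pD_weightFl {c : ℝ} (hc : 0 < c) (r : ℝ) {φ : ℝ → T3 → ℝ}
    (hφ : Literature.Analysis.FunctionSpaces.Torus.IsSmoothSpaceTimeOn Set.univ φ) (k : Fin 3) :
    Measurable fun p : (ℝ × Phase N) × T3 => pD k (fun y => φ p.1.1 y /
      max (2 / 3 * (kinC r p.1.2 y / max (rhoC r p.1.2 y) c - ‖momC r p.1.2 y‖ ^ 2 / (2 * max (rhoC r p.1.2 y) c ^ 2))) c)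
      p.2 := by
  have hF := psvT_continuous_weightFl (N := N) hc r hφ
  exact measurable_pD_uncurry (α := ℝ × Phase N) (f := fun a y => φ a.1 y /
      max (2 / 3 * (kinC r a.2 y / max (rhoC r a.2 y) c - ‖momC r a.2 y‖ ^ 2 / (2 * max (rhoC r a.2 y) c ^ 2))) c) hF k

/-- Along a good orbit, `(s, x) ↦ ∂ₖ(φ s ·/θfl_c(Φₛz, ·))(x)` is jointly Borel (the orbit is Borel in time). -/
theorem psvT_measurable_pD_weightFl_orbit {σ c : ℝ} (hc : 0 < c) (r : ℝ) (Φ : Flow σ N) {z : Phase N}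
    (hz : z ∈ Φ.good) {φ : ℝ → T3 → ℝ}
    (hφ : Literature.Analysis.FunctionSpaces.Torus.IsSmoothSpaceTimeOn Set.univ φ) (k : Fin 3) :
    Measurable fun q : ℝ × T3 =>
      pD k (fun y => φ q.1 y / max (2 / 3 * (kinC r (Φ.flow q.1 z) y / max (rhoC r (Φ.flow q.1 z) y) c -
        ‖momC r (Φ.flow q.1 z) y‖ ^ 2 / (2 * max (rhoC r (Φ.flow q.1 z) y) c ^ 2))) c) q.2 := by
  have hγ : Measurable fun s => Φ.flow s z := IsHardSphereTrajectory.measurable_torus (Φ.isTrajectory z hz)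
  have hswx : Measurable fun q : ℝ × T3 => ((((q.1, Φ.flow q.1 z) : ℝ × Phase N)), q.2) :=
    (measurable_fst.prodMk (hγ.comp measurable_fst)).prodMk measurable_snd
  have h := (psvT_measurable_pD_weightFl (N := N) hc r hφ k).comp hswx
  exact h

/-- Along a good orbit, `(s, x) ↦ q^kin_r(Φₛz, x)` is jointly Borel. -/
theorem psvT_measurable_qkinC_orbit (r : ℝ) {σ : ℝ} (Φ : Flow σ N) {z : Phase N} (hz : z ∈ Φ.good) :
    Measurable fun q : ℝ × T3 => qkinC r (Φ.flow q.1 z) q.2 := by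
  have hγ : Measurable fun s => Φ.flow s z := IsHardSphereTrajectory.measurable_torus (Φ.isTrajectory z hz)
  have hwx : Measurable fun q : ℝ × T3 => ((Φ.flow q.1 z, q.2) : Phase N × T3) :=
    (hγ.comp measurable_fst).prodMk measurable_snd
  have h := (psvT_measurable_qkinC_uncurry (N := N) r).comp hwx
  exact h

/-- Along a good orbit, a coordinate of `q^kin_r(Φₛz, x)` is jointly Borel in `(s, x)`. -/
theorem psvT_measurable_qkinC_orbit_apply (r : ℝ) {σ : ℝ} (Φ : Flow σ N) {z : Phase N} (hz : z ∈ Φ.good)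
    (k : Fin 3) : Measurable fun q : ℝ × T3 => qkinC r (Φ.flow q.1 z) q.2 k := by
  have h2 : Continuous fun v : V3 => v k := PiLp.continuous_apply 2 (fun _ : Fin 3 => ℝ) k
  have h := h2.measurable.comp (psvT_measurable_qkinC_orbit (N := N) r Φ hz)
  exact h

/-- The floored space–time integrand of `T₃kin` along a good orbit is jointly Borel in `(s, x)`. -/
theorem psvT_measurable_T₃kin_floored {σ r c : ℝ} (hc : 0 < c) (Φ : Flow σ N) {z : Phase N} (hz : z ∈ Φ.good)
    {φ : ℝ → T3 → ℝ} (hφ : Literature.Analysis.FunctionSpaces.Torus.IsSmoothSpaceTimeOn Set.univ φ) :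
    Measurable fun q : ℝ × T3 => ∑ k : Fin 3,
      pD k (fun y => φ q.1 y / max (2 / 3 * (kinC r (Φ.flow q.1 z) y / max (rhoC r (Φ.flow q.1 z) y) c -
        ‖momC r (Φ.flow q.1 z) y‖ ^ 2 / (2 * max (rhoC r (Φ.flow q.1 z) y) c ^ 2))) c) q.2 *
        qkinC r (Φ.flow q.1 z) q.2 k := by
  have hpD := fun k => psvT_measurable_pD_weightFl_orbit (N := N) hc r Φ hz hφ k
  have hq := fun k => psvT_measurable_qkinC_orbit_apply (N := N) r Φ hz k
  exact Finset.measurable_sum _ fun k _ => (hpD k).mul (hq k)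

/-- **The time integrand of `T₃kin` is integrable on `[0, τ]` on the regular event.**  `s ↦ ∫ ∑ₖ∂ₖ(φ/θ_r)q^kin_{r,k} dx`
(fields at `Φₛz`) is Borel on `[0, τ]` — it agrees there with the space integral of the jointly Borel FLOORED
integrand (Fubini measurability) — and bounded there (floors, `|∂θ_r| ≤ L_θ`, `‖q^kin_r‖ ≤ Q`, energy conservation). -/
theorem psvT_integrableOn_T₃kin_outer {σ r τ c η₁ : ℝ} (hr : 0 < r) (hc : 0 < c) {Φ : Flow σ N} {z : Phase N}
    (hz : Regular σ r τ c η₁ Φ z) {φ : ℝ → T3 → ℝ}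
    (hφ : Literature.Analysis.FunctionSpaces.Torus.IsSmoothSpaceTimeOn Set.univ φ) :
    IntegrableOn (fun s => ∫ x : T3, ∑ k : Fin 3,
      pD k (fun y => φ s y / thetaC r (Φ.flow s z) y) x * qkinC r (Φ.flow s z) x k) (Set.Icc (0 : ℝ) τ) := by
  obtain ⟨M, M', hM0, hM'0, hM, hM'⟩ := psvT_phi_bounds hφ τ
  have hGm : StronglyMeasurable fun s => ∫ x : T3, ∑ k : Fin 3,
      pD k (fun y => φ s y / max (2 / 3 * (kinC r (Φ.flow s z) y / max (rhoC r (Φ.flow s z) y) c -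
        ‖momC r (Φ.flow s z) y‖ ^ 2 / (2 * max (rhoC r (Φ.flow s z) y) c ^ 2))) c) x *
        qkinC r (Φ.flow s z) x k :=
    (psvT_measurable_T₃kin_floored (r := r) hc Φ hz.1 hφ).stronglyMeasurable.integral_prod_right'
  -- on `[0, τ]` the floored integrand is the true one
  have hfl : ∀ s ∈ Set.Icc (0 : ℝ) τ, ∀ y,
      max (2 / 3 * (kinC r (Φ.flow s z) y / max (rhoC r (Φ.flow s z) y) c -
        ‖momC r (Φ.flow s z) y‖ ^ 2 / (2 * max (rhoC r (Φ.flow s z) y) c ^ 2))) c = thetaC r (Φ.flow s z) y :=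
    fun s hs y => congrFun (psvT_thetaFl_eq_thetaC (fun y => hz.rhoC_ge hs y) (fun y => hz.thetaC_ge hs y)) y
  have hEq : Set.EqOn (fun s => ∫ x : T3, ∑ k : Fin 3,
      pD k (fun y => φ s y / max (2 / 3 * (kinC r (Φ.flow s z) y / max (rhoC r (Φ.flow s z) y) c -
        ‖momC r (Φ.flow s z) y‖ ^ 2 / (2 * max (rhoC r (Φ.flow s z) y) c ^ 2))) c) x *
        qkinC r (Φ.flow s z) x k)
      (fun s => ∫ x : T3, ∑ k : Fin 3,
        pD k (fun y => φ s y / thetaC r (Φ.flow s z) y) x * qkinC r (Φ.flow s z) x k) (Set.Icc (0 : ℝ) τ) := by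
    intro s hs
    simp only [hfl s hs]
  -- the bound on `[0, τ]` (energy conservation makes it uniform in `s`)
  obtain ⟨C, hC⟩ : ∃ C : ℝ, ∀ s ∈ Set.Icc (0 : ℝ) τ, ∀ x : T3,
      |∑ k : Fin 3, pD k (fun y => φ s y / thetaC r (Φ.flow s z) y) x * qkinC r (Φ.flow s z) x k| ≤ C :=
    ⟨_, fun s hs x => by
      have h1 := psvT_abs_T₃kin_integrand_le_floor hr hc (fun y => hz.rhoC_ge hs y) (hz.thetaC_ge hs x)
        (fun k => psvT_differentiableAt_line hφ s x _) (hM s hs x) (hM' s hs x)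
      rw [ke_flow_eq Φ hz.1 s] at h1
      exact h1⟩
  have hbound : ∀ s ∈ Set.Icc (0 : ℝ) τ, ‖∫ x : T3, ∑ k : Fin 3,
      pD k (fun y => φ s y / max (2 / 3 * (kinC r (Φ.flow s z) y / max (rhoC r (Φ.flow s z) y) c -
        ‖momC r (Φ.flow s z) y‖ ^ 2 / (2 * max (rhoC r (Φ.flow s z) y) c ^ 2))) c) x *
        qkinC r (Φ.flow s z) x k‖ ≤ C := by
    intro s hs
    simp only [hfl s hs]
    refine (norm_integral_le_of_norm_le_const (C := C) (Eventually.of_forall fun x => ?_)).trans ?_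
    · rw [Real.norm_eq_abs]; exact hC s hs x
    · simp
  have hInt : IntegrableOn (fun s => ∫ x : T3, ∑ k : Fin 3,
      pD k (fun y => φ s y / max (2 / 3 * (kinC r (Φ.flow s z) y / max (rhoC r (Φ.flow s z) y) c -
        ‖momC r (Φ.flow s z) y‖ ^ 2 / (2 * max (rhoC r (Φ.flow s z) y) c ^ 2))) c) x *
        qkinC r (Φ.flow s z) x k) (Set.Icc (0 : ℝ) τ) :=
    Measure.integrableOn_of_bounded measure_Icc_lt_top.ne hGm.aestronglyMeasurable
      ((ae_restrict_iff' measurableSet_Icc).2 (Eventually.of_forall hbound))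
  exact hInt.congr_fun hEq measurableSet_Icc

/-- **`T₃kin` is an honest double Bochner integral on the regular event** (`0 < r`, `0 < c`, smooth `φ`, `z`
regular): the time integrand is integrable on `[0, τ]` and at every `s ∈ [0, τ]` the space integrand is integrable. -/
theorem psvT_T₃kin_honest {σ r τ c η₁ : ℝ} (hr : 0 < r) (hc : 0 < c) {Φ : Flow σ N} {z : Phase N}
    (hz : Regular σ r τ c η₁ Φ z) {φ : ℝ → T3 → ℝ}
    (hφ : Literature.Analysis.FunctionSpaces.Torus.IsSmoothSpaceTimeOn Set.univ φ) :
    IntegrableOn (fun s => ∫ x : T3, ∑ k : Fin 3,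
        pD k (fun y => φ s y / thetaC r (Φ.flow s z) y) x * qkinC r (Φ.flow s z) x k) (Set.Icc (0 : ℝ) τ) ∧
      ∀ s ∈ Set.Icc (0 : ℝ) τ, Integrable (fun x => ∑ k : Fin 3,
        pD k (fun y => φ s y / thetaC r (Φ.flow s z) y) x * qkinC r (Φ.flow s z) x k) := by
  obtain ⟨M, M', hM0, hM'0, hM, hM'⟩ := psvT_phi_bounds hφ τ
  refine ⟨psvT_integrableOn_T₃kin_outer hr hc hz hφ, fun s hs => ?_⟩
  have hφc : Continuous (φ s) := (psvT_continuous_uncurry hφ).comp (Continuous.prodMk_right s)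
  exact psvT_integrable_T₃kin_inner hr hc (fun y => hz.rhoC_ge hs y) (fun y => hz.thetaC_ge hs y) hφc
    (fun x k => psvT_differentiableAt_line hφ s x _) (hM s hs) (hM' s hs)

/-! ## (b) The `L¹` majorant `∫₀^τ∫ ‖q^kin_r‖` is honest on the regular event -/

/-- `x ↦ ‖q^kin_r(x)‖` is integrable on the density floor. -/
theorem psvT_integrable_norm_qkinC {r c : ℝ} (hr : 0 < r) (hc : 0 < c) {w : Phase N} (hρ : ∀ y, c ≤ rhoC r w y) :
    Integrable fun x => ‖qkinC r w x‖ := by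
  refine Integrable.mono' (integrable_const (3 / (Real.pi * r ^ 3) *
      (1 / 2 + ((N + 1 : ℕ) : ℝ) * ke w + 3 / (Real.pi * r ^ 3) * (1 / 2 + ke w) / c) ^ 3 / 2))
    (psvT_measurable_norm_qkinC r w).aestronglyMeasurable (Eventually.of_forall fun x => ?_)
  rw [norm_norm]
  exact psvT_norm_qkinC_le hr hc (hρ x)

/-- `s ↦ ∫ ‖q^kin_r(Φₛz, x)‖ dx` is integrable on `[0, τ]` on the regular event. -/
theorem psvT_integrableOn_norm_qkinC {σ r τ c η₁ : ℝ} (hr : 0 < r) (hc : 0 < c) {Φ : Flow σ N} {z : Phase N}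
    (hz : Regular σ r τ c η₁ Φ z) :
    IntegrableOn (fun s => ∫ x : T3, ‖qkinC r (Φ.flow s z) x‖) (Set.Icc (0 : ℝ) τ) := by
  have hFm : Measurable fun q : ℝ × T3 => ‖qkinC r (Φ.flow q.1 z) q.2‖ :=
    (psvT_measurable_qkinC_orbit (N := N) r Φ hz.1).norm
  have hGm : StronglyMeasurable fun s => ∫ x : T3, ‖qkinC r (Φ.flow s z) x‖ :=
    hFm.stronglyMeasurable.integral_prod_right'
  obtain ⟨Q, hQ⟩ : ∃ Q : ℝ, ∀ s ∈ Set.Icc (0 : ℝ) τ, ∀ x : T3, ‖qkinC r (Φ.flow s z) x‖ ≤ Q :=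
    ⟨_, fun s hs x => by
      have h2 := psvT_norm_qkinC_le hr hc (hz.rhoC_ge hs x)
      rw [ke_flow_eq Φ hz.1 s] at h2
      exact h2⟩
  have hbound : ∀ s ∈ Set.Icc (0 : ℝ) τ, ‖∫ x : T3, ‖qkinC r (Φ.flow s z) x‖‖ ≤ Q := by
    intro s hs
    refine (norm_integral_le_of_norm_le_const (C := Q) (Eventually.of_forall fun x => ?_)).trans ?_
    · rw [norm_norm]; exact hQ s hs x
    · simp
  exact Measure.integrableOn_of_bounded (s := Set.Icc (0 : ℝ) τ) measure_Icc_lt_top.ne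
    hGm.aestronglyMeasurable ((ae_restrict_iff' measurableSet_Icc).2 (Eventually.of_forall hbound))

/-! ## (c) The deterministic core of P3 -/

/-- **Deterministic core of P3.**  On a regular orbit (`0 < r`, `0 < c`, `0 ≤ τ`) with a smooth weight `φ`,
`|φ| ≤ M`, `|∂ₖφ| ≤ M'` and the thermal strain bound `r|∂ₖθ_r| ≤ K` on `[0, τ] × 𝕋³`:
`|T₃kin| ≤ 3(M'/c + MK/(rc²)) ∫₀^τ∫ ‖q^kin_r‖` — only the MAJORANT needs honest integrals. -/
theorem psvT_abs_T₃kin_le {σ r τ c η₁ : ℝ} (hr : 0 < r) (hc : 0 < c) (hτ : 0 ≤ τ) {Φ : Flow σ N} {z : Phase N}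
    (hz : Regular σ r τ c η₁ Φ z) {φ : ℝ → T3 → ℝ}
    (hφ : Literature.Analysis.FunctionSpaces.Torus.IsSmoothSpaceTimeOn Set.univ φ) {M M' K : ℝ}
    (hM : ∀ s ∈ Set.Icc (0 : ℝ) τ, ∀ x, |φ s x| ≤ M)
    (hM' : ∀ s ∈ Set.Icc (0 : ℝ) τ, ∀ x, ∀ k : Fin 3, |pD k (φ s) x| ≤ M')
    (hK : ∀ s ∈ Set.Icc (0 : ℝ) τ, ∀ x, ∀ k : Fin 3, r * |pD k (fun y => thetaC r (Φ.flow s z) y) x| ≤ K) :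
    |T₃kin σ r τ φ Φ z| ≤ 3 * (M' / c + M * K / (r * c ^ 2)) *
      ∫ s in Set.Icc (0 : ℝ) τ, ∫ x : T3, ‖qkinC r (Φ.flow s z) x‖ := by
  have h0 : (0 : ℝ) ∈ Set.Icc (0 : ℝ) τ := ⟨le_rfl, hτ⟩
  have hM0 : 0 ≤ M := (abs_nonneg _).trans (hM 0 h0 0)
  have hM'0 : 0 ≤ M' := (abs_nonneg _).trans (hM' 0 h0 0 0)
  have hK0 : 0 ≤ K := le_trans (mul_nonneg hr.le (abs_nonneg _)) (hK 0 h0 0 0)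
  set W : ℝ := 3 * (M' / c + M * K / (r * c ^ 2)) with hW
  have hW0 : 0 ≤ W := by positivity
  -- space level
  have hspace : ∀ s ∈ Set.Icc (0 : ℝ) τ, ‖∫ x : T3, ∑ k : Fin 3,
      pD k (fun y => φ s y / thetaC r (Φ.flow s z) y) x * qkinC r (Φ.flow s z) x k‖ ≤
      W * ∫ x : T3, ‖qkinC r (Φ.flow s z) x‖ := by
    intro s hs
    set w := Φ.flow s z with hw
    have hρ : ∀ y, c ≤ rhoC r w y := fun y => hz.rhoC_ge hs y
    have hθ : ∀ y, c ≤ thetaC r w y := fun y => hz.thetaC_ge hs y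
    have hθc := psvT_continuous_thetaC (r := r) hc hρ
    rw [← integral_const_mul]
    refine norm_integral_le_of_norm_le ((psvT_integrable_norm_qkinC hr hc hρ).const_mul W)
      (Eventually.of_forall fun x => ?_)
    rw [Real.norm_eq_abs]
    have hD : ∀ k, |pD k (fun y => thetaC r w y) x| ≤ K / r := fun k => by
      rw [le_div_iff₀ hr, mul_comm]; exact hK s hs x k
    have h1 := psvT_abs_T₃kin_integrand_le hc (hθ x) hθc (fun k => psvT_differentiableAt_line hφ s x _)
      (hM s hs x) (hM' s hs x) hD
    refine h1.trans (le_of_eq ?_)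
    rw [hW]
    congr 1
    field_simp
  -- time level
  have hAint_s := (psvT_integrableOn_norm_qkinC (τ := τ) hr hc hz).const_mul W
  unfold T₃kin
  rw [← integral_const_mul]
  have h := norm_integral_le_of_norm_le hAint_s ((ae_restrict_iff' measurableSet_Icc).2 (Eventually.of_forall hspace))
  rw [Real.norm_eq_abs] at h
  exact h

/-! ## Registered sub-goals (stmt-AtomisticToContinuum-13081; signatures verbatim) -/

/-- Registered sub-goal `T3kin_honest_of_regular`: on the regular event both Bochner integrals of `T₃kin` are honest. -/
theorem T3kin_honest_of_regular :
  ∀ {N : ℕ} {σ r τ c η₁ : ℝ}, 0 < r → 0 < c → ∀ {Φ : Flow σ N} {z : Phase N}, Regular σ r τ c η₁ Φ z → ∀ {φ : ℝ → T3 → ℝ}, Literature.Analysis.FunctionSpaces.Torus.IsSmoothSpaceTimeOn Set.univ φ → IntegrableOn (fun s => ∫ x : T3, ∑ k : Fin 3, pD k (fun y => φ s y / thetaC r (Φ.flow s z) y) x * qkinC r (Φ.flow s z) x k) (Set.Icc (0 : ℝ) τ) ∧ ∀ s ∈ Set.Icc (0 : ℝ) τ, Integrable (fun x => ∑ k : Fin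 3, pD k (fun y => φ s y / thetaC r (Φ.flow s z) y) x * qkinC r (Φ.flow s z) x k) :=
  fun hr hc _ _ hz _ hφ => psvT_T₃kin_honest hr hc hz hφ

/-- Registered sub-goal `abs_T3kin_le_of_regular`: the deterministic core of P3. -/
theorem abs_T3kin_le_of_regular :
  ∀ {N : ℕ} {σ r τ c η₁ : ℝ}, 0 < r → 0 < c → 0 ≤ τ → ∀ {Φ : Flow σ N} {z : Phase N}, Regular σ r τ c η₁ Φ z → ∀ {φ : ℝ → T3 → ℝ}, Literature.Analysis.FunctionSpaces.Torus.IsSmoothSpaceTimeOn Set.univ φ → ∀ {M M' K : ℝ}, (∀ s ∈ Set.Icc (0 : ℝ) τ, ∀ x, |φ s x| ≤ M) → (∀ s ∈ Set.Icc (0 : ℝ) τ, ∀ x, ∀ k : Fin 3, |pD k (φ s) x| ≤ M') → (∀ s ∈ Set.Icc (0 : ℝ) τ, ∀ x, ∀ k : Fin 3, r * |pD k (fun y => thetaC r (Φ.flow s z) y) x| ≤ K) → |T₃kin σ r τ φ Φ z| ≤ 3 * (M' / c + M * K / (r * c ^ 2)) * ∫ s in Set.Icc (0 : ℝ) τ,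 ∫ x : T3, ‖qkinC r (Φ.flow s z) x‖ :=
  fun hr hc hτ _ _ hz _ hφ _ _ _ hM hM' hK => psvT_abs_T₃kin_le hr hc hτ hz hφ hM hM' hK

end Summit.AtomisticToContinuum.HydrodynamicLimit.Theorems.LocalSecondLawLedger

end
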